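import Mathlib.Algebra.Homology.HomologySequence
import Mathlib.Algebra.Homology.HomologicalComplexAbelian
import Mathlib.Algebra.Homology.ConcreteCategory
import Mathlib.Algebra.Category.ModuleCat.Abelian
import Mathlib.LinearAlgebra.Quotient.Basic
import Mathlib.LinearAlgebra.Pi
import Literature.AlgebraicTopology.SingularHomology.ChainSubcomplex
import HarnessLib

/-!
# The Milnor `lim¹` sequence of a tower of cochain complexes

J. Milnor, *On axiomatic homology theory*, Pacific J. Math. 12 (1962) 337–341, Lemma 2 / A. Hatcher,
*Algebraic Topology* (2002), §3.F, Thm. 3F.8 (p. 313) in its algebraic form (C. Weibel,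
*An Introduction to Homological Algebra*, Thm. 3.5.8): for a tower
`⋯ → C(2) → C(1) → C(0)` of cochain complexes of `R`-modules with SURJECTIVE transition maps, the
inverse limit complex `lim C(n)` has cohomology in natural short exact sequences

`0 → lim¹ₙ Hᵏ⁻¹(C(n)) → Hᵏ(lim C(n)) → limₙ Hᵏ(C(n)) → 0`.

Proof as printed: the short exact sequence of complexes `0 → lim C(n) → Π C(n) →(1 - shift) Π C(n) → 0`
(surjectivity of `1 - shift` from that of the transition maps), its long exact cohomology sequence
(Mathlib's `ShortComplex.ShortExact.δ`, `homology_exact₁/₂/₃`), `Hᵏ(Π C(n)) = Π Hᵏ(C(n))`, and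
`lim = ker (1 - shift)`, `lim¹ = coker (1 - shift)` on towers of modules.

* `towerD r = 1 - shift`, `towerLim r = ker`, `towerLim1 r = coker` for a tower of modules `r n : M (n+1) → M n`;
  functoriality (`towerLimMap`, `towerLim1Map`); `towerD_surjective` (epimorphic towers have `lim¹ = 0`);
* `piCx C`, `DMap C ρ`, `limCx C ρ`, `milnorSC C ρ` and `milnorSC_shortExact`;
* `piHomologyEquiv : Hᵏ(Π C(n)) ≃ Π Hᵏ(C(n))`;
* **`milnorSurj`** `: Hᵏ(lim C) → lim Hᵏ(C(n))` surjective, **`milnorInj`** `: lim¹ Hᵏ⁻¹(C(n)) → Hᵏ(lim C)`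
  injective, exact in the middle (`milnor_exact`), and natural in the tower; the short five lemma
  consequence `homologyMap_limCx_bijective`.

Everything is proved; no named facts.

## References

* J. Milnor, *On axiomatic homology theory*, Pacific J. Math. 12 (1962), Lemma 2. [Milnor1962]
* A. Hatcher, *Algebraic Topology*, CUP 2002, §3.F Thm. 3F.8. [HatcherAT2002]
* C. Weibel, *An Introduction to Homological Algebra*, CUP 1994, §3.5 Thm. 3.5.8. [Weibel1994]
-/

noncomputable section

open CategoryTheory CategoryTheory.Limits Function

universe w u

namespace Literature.AlgebraicTopology.SingularHomology

variable {R : Type u} [CommRing R]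

/-! ### Towers of modules: `lim` and `lim¹` -/

section Modules

variable {M : ℕ → Type w} [∀ n, AddCommGroup (M n)] [∀ n, Module R (M n)] (r : ∀ n, M (n + 1) →ₗ[R] M n)

/-- The shift `(xₙ) ↦ (r xₙ₊₁)` of a tower. [folklore] -/
def towerShift : (∀ n, M n) →ₗ[R] (∀ n, M n) :=
  LinearMap.pi fun n ↦ (r n).comp (LinearMap.proj (n + 1))

/-- The shift, applied. [folklore] -/
@[simp] theorem towerShift_apply (x : ∀ n, M n) (n : ℕ) : towerShift r x n = r n (x (n + 1)) := rfl

/-- **`1 - shift` on `Π M(n)`**, whose kernel is `lim` and cokernel `lim¹`. [cite: Weibel1994, §3.5 Def. 3.5.1] -/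
def towerD : (∀ n, M n) →ₗ[R] (∀ n, M n) := LinearMap.id - towerShift r

/-- `1 - shift`, applied. [folklore] -/
@[simp] theorem towerD_apply (x : ∀ n, M n) (n : ℕ) : towerD r x n = x n - r n (x (n + 1)) := rfl

/-- **`lim M(n) = ker (1 - shift)`**: compatible sequences. [cite: Weibel1994, §3.5 Def. 3.5.1] -/
abbrev towerLim : Submodule R (∀ n, M n) := LinearMap.ker (towerD r)

/-- **`lim¹ M(n) = coker (1 - shift)`**. [cite: Weibel1994, §3.5 Def. 3.5.1] -/
abbrev towerLim1 : Type w := (∀ n, M n) ⧸ LinearMap.range (towerD r)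

/-- Membership in `lim`: compatibility. [folklore] -/
theorem mem_towerLim_iff (x : ∀ n, M n) : x ∈ towerLim r ↔ ∀ n, r n (x (n + 1)) = x n := by
  simp only [LinearMap.mem_ker, funext_iff, towerD_apply, Pi.zero_apply, sub_eq_zero]
  exact ⟨fun h n ↦ (h n).symm, fun h n ↦ (h n).symm⟩

/-- **An epimorphic tower has `1 - shift` surjective** (so `lim¹ = 0`, the Mittag-Leffler case):
solve `xₙ - r xₙ₊₁ = yₙ` recursively upwards. [cite: Weibel1994, §3.5 Lemma 3.5.3] -/
theorem towerD_surjective (hr : ∀ n, Surjective (r n)) : Surjective (towerD r) := by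
  intro y
  -- recursive solution: x 0 = 0, x (n+1) = a preimage of x n - y n
  let x : ∀ n, M n := fun n ↦ Nat.rec (motive := fun n ↦ M n) 0 (fun n xn ↦ surjInv (hr n) (xn - y n)) n
  refine ⟨x, funext fun n ↦ ?_⟩
  rw [towerD_apply]
  have hx : x (n + 1) = surjInv (hr n) (x n - y n) := rfl
  rw [hx, surjInv_eq (hr n), sub_sub_cancel]

/-- `lim¹` of an epimorphic tower vanishes. [cite: Weibel1994, §3.5 Lemma 3.5.3] -/
theorem subsingleton_towerLim1 (hr : ∀ n, Surjective (r n)) : Subsingleton (towerLim1 r) := by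
  refine ⟨fun a b ↦ ?_⟩
  induction a using Submodule.Quotient.induction_on with
  | H a =>
    induction b using Submodule.Quotient.induction_on with
    | H b =>
      rw [Submodule.Quotient.eq, LinearMap.range_eq_top.2 (towerD_surjective r hr)]
      exact Submodule.mem_top

variable {N : ℕ → Type w} [∀ n, AddCommGroup (N n)] [∀ n, Module R (N n)] (s : ∀ n, N (n + 1) →ₗ[R] N n)
  (f : ∀ n, M n →ₗ[R] N n) (hf : ∀ n (x : M (n + 1)), f n (r n x) = s n (f (n + 1) x))

/-- The componentwise map `Π M(n) → Π N(n)` of a morphism of towers. [folklore] -/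
def towerPiMap : (∀ n, M n) →ₗ[R] (∀ n, N n) := LinearMap.pi fun n ↦ (f n).comp (LinearMap.proj n)

/-- The componentwise map, applied. [folklore] -/
@[simp] theorem towerPiMap_apply (x : ∀ n, M n) (n : ℕ) : towerPiMap f x n = f n (x n) := rfl

include hf in
/-- A morphism of towers commutes with `1 - shift`. [folklore] -/
theorem towerD_comp_towerPiMap : (towerD s).comp (towerPiMap f) = (towerPiMap f).comp (towerD r) := by
  ext x n
  simp [hf]

include hf in
/-- A morphism of towers commutes with `1 - shift`, applied. [folklore] -/
theorem towerD_towerPiMap (x : ∀ n, M n) : towerD s (towerPiMap f x) = towerPiMap f (towerD r x) :=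
  LinearMap.congr_fun (towerD_comp_towerPiMap r s f hf) x

/-- **`lim` is a functor**: the induced map on compatible sequences. [folklore] -/
def towerLimMap : towerLim r →ₗ[R] towerLim s :=
  (towerPiMap f).restrict fun x hx ↦ by
    rw [LinearMap.mem_ker] at hx ⊢
    rw [towerD_towerPiMap r s f hf, hx, map_zero]

/-- `lim` of a morphism, applied. [folklore] -/
@[simp] theorem towerLimMap_apply_coe (x : towerLim r) (n : ℕ) : (towerLimMap r s f hf x : ∀ n, N n) n = f n (x.1 n) := rfl

/-- **`lim¹` is a functor**: the induced map on cokernels. [folklore] -/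
def towerLim1Map : towerLim1 r →ₗ[R] towerLim1 s :=
  Submodule.mapQ _ _ (towerPiMap f) fun y hy ↦ by
    obtain ⟨x, rfl⟩ := LinearMap.mem_range.1 hy
    exact LinearMap.mem_range.2 ⟨towerPiMap f x, towerD_towerPiMap r s f hf x⟩

/-- `lim¹` of a morphism on a representative. [folklore] -/
@[simp] theorem towerLim1Map_mk (x : ∀ n, M n) :
    towerLim1Map r s f hf (Submodule.Quotient.mk x) = Submodule.Quotient.mk (towerPiMap f x) := rfl

end Modules

/-! ### Towers of cochain complexes: the product, `1 - shift`, and the limit complex -/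

section Complexes

variable (C : ℕ → CochainComplex (ModuleCat.{w} R) ℕ) (ρ : ∀ n, C (n + 1) ⟶ C n)

/-- The tower of `k`-cochains `n ↦ C(n)ᵏ`. [folklore] -/
abbrev XTower (k : ℕ) : ℕ → Type w := fun n ↦ (C n).X k

/-- **The product complex `Π C(n)`** (degreewise product, componentwise differential). [folklore] -/
def piCx : CochainComplex (ModuleCat.{w} R) ℕ where
  X k := ModuleCat.of R (∀ n, (C n).X k)
  d k l := ModuleCat.ofHom (LinearMap.pi fun n ↦ ((C n).d k l).hom.comp (LinearMap.proj n))
  shape k l hkl := by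
    refine ModuleCat.hom_ext (LinearMap.ext fun x ↦ funext fun n ↦ ?_)
    change (C n).d k l (x n) = 0
    rw [(C n).shape k l hkl]
    rfl
  d_comp_d' k l m _ _ := by
    refine ModuleCat.hom_ext (LinearMap.ext fun x ↦ funext fun n ↦ ?_)
    change ((C n).d l m) (((C n).d k l) (x n)) = 0
    rw [← ModuleCat.comp_apply, (C n).d_comp_d]
    rfl

/-- The differential of the product complex, applied. [folklore] -/
@[simp] theorem piCx_d_apply (k l : ℕ) (x : ∀ n, (C n).X k) (n : ℕ) : (piCx C).d k l x n = (C n).d k l (x n) := rfl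

/-- The projection `Π C(n) → C(n)`. [folklore] -/
def piProj (n : ℕ) : piCx C ⟶ C n where
  f _ := ModuleCat.ofHom (LinearMap.proj n)
  comm' _ _ _ := rfl

/-- The projection, applied. [folklore] -/
@[simp] theorem piProj_f_apply (n k : ℕ) (x : ∀ m, (C m).X k) : (piProj C n).f k x = x n := rfl

/-- The transition maps in degree `k`, as linear maps of the tower `XTower C k`. [folklore] -/
abbrev ρLin (k : ℕ) : ∀ n, XTower C k (n + 1) →ₗ[R] XTower C k n := fun n ↦ ((ρ n).f k).hom

/-- The transition maps commute with the differentials, applied. [folklore] -/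
theorem ρ_d_apply (k l n : ℕ) (y : (C (n + 1)).X k) : (ρ n).f l ((C (n + 1)).d k l y) = (C n).d k l ((ρ n).f k y) := by
  rw [← ModuleCat.comp_apply, ← (ρ n).comm k l, ModuleCat.comp_apply]

/-- **`1 - shift : Π C(n) → Π C(n)`**, a cochain map. [cite: Weibel1994, §3.5 Thm. 3.5.8] -/
def DMap : piCx C ⟶ piCx C where
  f k := ModuleCat.ofHom (towerD (M := XTower C k) (ρLin C ρ k))
  comm' k l _ := by
    refine ModuleCat.hom_ext (LinearMap.ext fun x ↦ funext fun n ↦ ?_)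
    change (C n).d k l (towerD (M := XTower C k) (ρLin C ρ k) x n) =
      towerD (M := XTower C l) (ρLin C ρ l) (fun n ↦ (C n).d k l (x n)) n
    rw [towerD_apply, towerD_apply, map_sub]
    exact congrArg _ (ρ_d_apply C ρ k l n (x (n + 1))).symm

/-- `1 - shift` on cochains, applied. [folklore] -/
@[simp] theorem DMap_f_apply (k : ℕ) (x : ∀ n, (C n).X k) (n : ℕ) :
    (DMap C ρ).f k x n = x n - (ρ n).f k (x (n + 1)) := rfl

/-- The limit in degree `k`: compatible sequences of `k`-cochains. [folklore] -/
abbrev limX (k : ℕ) : Submodule R (∀ n, (C n).X k) := towerLim (M := XTower C k) (ρLin C ρ k)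

/-- The differential preserves compatibility. [folklore] -/
theorem d_mem_limX {k : ℕ} (l : ℕ) {x : ∀ n, (C n).X k} (hx : x ∈ limX C ρ k) :
    (fun n ↦ (C n).d k l (x n)) ∈ limX C ρ l := by
  refine (mem_towerLim_iff (M := XTower C l) (ρLin C ρ l) _).2 fun n ↦ ?_
  have hx' := (mem_towerLim_iff (M := XTower C k) (ρLin C ρ k) x).1 hx n
  change (ρ n).f l ((C (n + 1)).d k l (x (n + 1))) = (C n).d k l (x n)
  rw [ρ_d_apply]
  exact congrArg _ hx'

/-- **The inverse limit complex `lim C(n)`**: compatible sequences, degreewise. [cite: Weibel1994, §3.5 Thm. 3.5.8] -/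
def limCx : CochainComplex (ModuleCat.{w} R) ℕ where
  X k := ModuleCat.of R (limX C ρ k)
  d k l := ModuleCat.ofHom (((piCx C).d k l).hom.restrict fun x hx ↦ d_mem_limX C ρ l hx)
  shape k l hkl := by
    refine ModuleCat.hom_ext (LinearMap.ext fun x ↦ Subtype.ext ?_)
    change (piCx C).d k l x.1 = 0
    rw [(piCx C).shape k l hkl]
    rfl
  d_comp_d' k l m _ _ := by
    refine ModuleCat.hom_ext (LinearMap.ext fun x ↦ Subtype.ext ?_)
    change (piCx C).d l m ((piCx C).d k l x.1) = 0
    rw [← ModuleCat.comp_apply, (piCx C).d_comp_d]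
    rfl

/-- The differential of the limit complex, applied. [folklore] -/
@[simp] theorem limCx_d_apply_coe (k l : ℕ) (x : limX C ρ k) :
    ((limCx C ρ).d k l x : limX C ρ l).1 = fun n ↦ (C n).d k l (x.1 n) := rfl

/-- The inclusion `lim C(n) → Π C(n)`. [folklore] -/
def ιMap : limCx C ρ ⟶ piCx C where
  f _ := ModuleCat.ofHom (Submodule.subtype _)
  comm' _ _ _ := rfl

/-- The inclusion, applied. [folklore] -/
@[simp] theorem ιMap_f_apply (k : ℕ) (x : limX C ρ k) : (ιMap C ρ).f k x = x.1 := rfl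

/-- **The Milnor short complex of complexes `0 → lim C → Π C →(1 - shift) Π C → 0`.** [cite: Weibel1994, §3.5 Thm. 3.5.8] -/
def milnorSC : ShortComplex (CochainComplex (ModuleCat.{w} R) ℕ) where
  X₁ := limCx C ρ
  X₂ := piCx C
  X₃ := piCx C
  f := ιMap C ρ
  g := DMap C ρ
  zero := by
    ext k x
    exact LinearMap.mem_ker.1 x.2

/-- **The Milnor short complex is short exact** when the transition maps are surjective. [cite: Weibel1994, §3.5 Thm. 3.5.8] -/
theorem milnorSC_shortExact (hρ : ∀ n k, Surjective ((ρ n).f k)) : (milnorSC C ρ).ShortExact := by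
  refine HomologicalComplex.shortExact_of_degreewise_shortExact _ fun k ↦ ?_
  have hexact : ((milnorSC C ρ).map (HomologicalComplex.eval (ModuleCat R) (ComplexShape.up ℕ) k)).Exact := by
    rw [ShortComplex.moduleCat_exact_iff]
    intro x hx
    exact ⟨(⟨x, LinearMap.mem_ker.2 hx⟩ : limX C ρ k), rfl⟩
  have hmono : Mono ((milnorSC C ρ).map (HomologicalComplex.eval (ModuleCat R) (ComplexShape.up ℕ) k)).f := by
    change Mono ((ιMap C ρ).f k)
    rw [ModuleCat.mono_iff_injective]
    exact Subtype.val_injective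
  have hepi : Epi ((milnorSC C ρ).map (HomologicalComplex.eval (ModuleCat R) (ComplexShape.up ℕ) k)).g := by
    change Epi ((DMap C ρ).f k)
    rw [ModuleCat.epi_iff_surjective]
    exact towerD_surjective (M := XTower C k) (ρLin C ρ k) fun n ↦ hρ n k
  exact ShortComplex.ShortExact.mk' hexact hmono hepi

end Complexes

/-! ### `Hᵏ(Π C(n)) = Π Hᵏ(C(n))` -/

section Homology

variable (C : ℕ → CochainComplex (ModuleCat.{w} R) ℕ) (ρ : ∀ n, C (n + 1) ⟶ C n)

/-- The comparison `Hᵏ(Π C(n)) → Π Hᵏ(C(n))`, `x ↦ (projₙ* x)ₙ`. [folklore] -/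
def piHomologyMap (k : ℕ) : (piCx C).homology k →ₗ[R] ∀ n, (C n).homology k :=
  LinearMap.pi fun n ↦ (HomologicalComplex.homologyMap (piProj C n) k).hom

/-- The comparison map, applied. [folklore] -/
@[simp] theorem piHomologyMap_apply (k : ℕ) (x : (piCx C).homology k) (n : ℕ) :
    piHomologyMap C k x n = HomologicalComplex.homologyMap (piProj C n) k x := rfl

/-- The class of a product cocycle projects to the classes of its components. [folklore] -/
theorem piHomologyMap_homologyCls (k : ℕ) (z : ∀ n, (C n).X k)
    (hz : (piCx C).d k ((ComplexShape.up ℕ).next k) z = 0) (n : ℕ) :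
    piHomologyMap C k (homologyCls (K := piCx C) z hz) n =
      homologyCls (K := C n) (z n) (by have := congrFun (congrArg (fun v : (∀ m, (C m).X _) ↦ v) hz) n; exact this) := by
  rw [piHomologyMap_apply, homologyMap_homologyCls]
  rfl

/-- **`Hᵏ(Π C(n)) → Π Hᵏ(C(n))` is bijective** (products are exact in `R`-modules). [cite: Weibel1994, §3.5 (proof of Thm. 3.5.8)] -/
theorem piHomologyMap_bijective (k : ℕ) : Bijective (piHomologyMap C k) := by
  constructor
  · rw [injective_iff_map_eq_zero]
    intro x hx
    obtain ⟨z, hz, rfl⟩ := homologyCls_surjective (K := piCx C) x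
    -- each component is a coboundary
    have hn : ∀ n, ∃ w : (C n).X ((ComplexShape.up ℕ).prev k), (C n).d _ k w = z n := by
      intro n
      have h := congrFun hx n
      rw [piHomologyMap_homologyCls, Pi.zero_apply, homologyCls_eq_zero_iff] at h
      exact h
    choose w hw using hn
    exact (homologyCls_eq_zero_iff (K := piCx C) z hz).2 ⟨w, funext hw⟩
  · intro y
    have hn : ∀ n, ∃ (z : (C n).X k) (hz : (C n).d k ((ComplexShape.up ℕ).next k) z = 0), homologyCls z hz = y n :=
      fun n ↦ homologyCls_surjective (y n)
    choose z hz hzy using hn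
    refine ⟨homologyCls (K := piCx C) z (funext fun n ↦ hz n), funext fun n ↦ ?_⟩
    rw [piHomologyMap_homologyCls]
    exact hzy n

/-- `Hᵏ(Π C(n)) ≃ Π Hᵏ(C(n))`. [folklore] -/
def piHomologyEquiv (k : ℕ) : (piCx C).homology k ≃ₗ[R] ∀ n, (C n).homology k :=
  LinearEquiv.ofBijective (piHomologyMap C k) (piHomologyMap_bijective C k)

/-- The comparison equivalence is the comparison map. [folklore] -/
@[simp] theorem piHomologyEquiv_apply (k : ℕ) (x : (piCx C).homology k) : piHomologyEquiv C k x = piHomologyMap C k x := rfl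

/-- The tower of cohomology modules `n ↦ Hᵏ(C(n))`. [folklore] -/
abbrev HTower (k : ℕ) : ℕ → Type w := fun n ↦ (C n).homology k

/-- Its transition maps `ρₙ* : Hᵏ(C(n+1)) → Hᵏ(C(n))`. [folklore] -/
abbrev ρH (k : ℕ) : ∀ n, HTower C k (n + 1) →ₗ[R] HTower C k n := fun n ↦ (HomologicalComplex.homologyMap (ρ n) k).hom

/-- `projₙ ∘ (1 - shift) = projₙ - ρₙ ∘ projₙ₊₁` as cochain maps. [folklore] -/
theorem piProj_comp_DMap (n : ℕ) : DMap C ρ ≫ piProj C n = piProj C n - piProj C (n + 1) ≫ ρ n := by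
  ext k x
  rfl

/-- **Under `Hᵏ(Π C) = Π Hᵏ(C(n))`, `(1 - shift)*` is `1 - shift` of the cohomology tower.** [folklore] -/
theorem piHomologyMap_homologyMap_DMap (k : ℕ) (x : (piCx C).homology k) :
    piHomologyMap C k (HomologicalComplex.homologyMap (DMap C ρ) k x) =
      towerD (M := HTower C k) (ρH C ρ k) (piHomologyMap C k x) := by
  funext n
  rw [piHomologyMap_apply, towerD_apply, piHomologyMap_apply, piHomologyMap_apply, ← ModuleCat.comp_apply,
    ← HomologicalComplex.homologyMap_comp, piProj_comp_DMap, HomologicalComplex.homologyMap_sub,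
    HomologicalComplex.homologyMap_comp]
  rfl

end Homology

/-! ### The Milnor exact sequence -/

section Milnor

variable (C : ℕ → CochainComplex (ModuleCat.{w} R) ℕ) (ρ : ∀ n, C (n + 1) ⟶ C n)
  (hρ : ∀ n k, Surjective ((ρ n).f k))

/-- `ι*` lands in compatible families: `ρₙ* (ι* x)ₙ₊₁ = (ι* x)ₙ`. [folklore] -/
theorem piHomologyMap_ι_mem (k : ℕ) (x : (limCx C ρ).homology k) :
    piHomologyMap C k (HomologicalComplex.homologyMap (ιMap C ρ) k x) ∈ towerLim (M := HTower C k) (ρH C ρ k) := by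
  rw [LinearMap.mem_ker, ← piHomologyMap_homologyMap_DMap, ← ModuleCat.comp_apply, ← HomologicalComplex.homologyMap_comp]
  have h0 : ιMap C ρ ≫ DMap C ρ = 0 := (milnorSC C ρ).zero
  rw [h0, HomologicalComplex.homologyMap_zero]
  change piHomologyMap C k ((0 : (limCx C ρ).homology k ⟶ (piCx C).homology k).hom x) = 0
  rw [ModuleCat.hom_zero, LinearMap.zero_apply, map_zero]

/-- **The Milnor surjection `Hᵏ(lim C(n)) → lim Hᵏ(C(n))`**, `x ↦ (x|ₙ)ₙ`. [cite: HatcherAT2002, §3.F Thm. 3F.8] -/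
def milnorSurj (k : ℕ) : (limCx C ρ).homology k →ₗ[R] towerLim (M := HTower C k) (ρH C ρ k) :=
  LinearMap.codRestrict _ ((piHomologyMap C k).comp (HomologicalComplex.homologyMap (ιMap C ρ) k).hom)
    (piHomologyMap_ι_mem C ρ k)

/-- The Milnor surjection, applied. [folklore] -/
@[simp] theorem milnorSurj_apply_coe (k : ℕ) (x : (limCx C ρ).homology k) :
    (milnorSurj C ρ k x : ∀ n, (C n).homology k) = piHomologyMap C k (HomologicalComplex.homologyMap (ιMap C ρ) k x) := rfl

include hρ in
/-- **The Milnor surjection is surjective.** [cite: HatcherAT2002, §3.F Thm. 3F.8] -/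
theorem milnorSurj_surjective (k : ℕ) : Surjective (milnorSurj C ρ k) := by
  intro y
  obtain ⟨Y, hY⟩ := (piHomologyMap_bijective C k).2 y.1
  have hDY : HomologicalComplex.homologyMap (DMap C ρ) k Y = 0 := by
    apply (piHomologyMap_bijective C k).1
    rw [piHomologyMap_homologyMap_DMap, hY, map_zero]
    exact LinearMap.mem_ker.1 y.2
  obtain ⟨x, hx⟩ := (ShortComplex.moduleCat_exact_iff _).1
    ((milnorSC_shortExact C ρ hρ).homology_exact₂ k) Y hDY
  refine ⟨x, Subtype.ext ?_⟩
  rw [milnorSurj_apply_coe, ← hY]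
  exact congrArg _ hx

/-- The relation `k ~ k + 1` of the cohomological shape. [folklore] -/
theorem crel_up (k : ℕ) : (ComplexShape.up ℕ).Rel k (k + 1) := rfl

/-- **The connecting map `Hᵏ(Π C) → Hᵏ⁺¹(lim C)` of the Milnor short exact sequence.** [cite: Weibel1994, §3.5 Thm. 3.5.8] -/
def milnorδ (k : ℕ) : (piCx C).homology k ⟶ (limCx C ρ).homology (k + 1) :=
  (milnorSC_shortExact C ρ hρ).δ k (k + 1) (crel_up k)

/-- `δ ∘ (1 - shift)* = 0`. [folklore] -/
theorem milnorδ_homologyMap_DMap (k : ℕ) (Y : (piCx C).homology k) :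
    milnorδ C ρ hρ k (HomologicalComplex.homologyMap (DMap C ρ) k Y) = 0 := by
  change (HomologicalComplex.homologyMap (milnorSC C ρ).g k ≫ (milnorSC_shortExact C ρ hρ).δ k (k + 1) (crel_up k)) Y = 0
  rw [(milnorSC_shortExact C ρ hρ).comp_δ]
  rfl

/-- `ι* ∘ δ = 0`. [folklore] -/
theorem homologyMap_ιMap_milnorδ (k : ℕ) (Y : (piCx C).homology k) :
    HomologicalComplex.homologyMap (ιMap C ρ) (k + 1) (milnorδ C ρ hρ k Y) = 0 := by
  change ((milnorSC_shortExact C ρ hρ).δ k (k + 1) (crel_up k) ≫ HomologicalComplex.homologyMap (milnorSC C ρ).f (k + 1)) Y = 0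
  rw [(milnorSC_shortExact C ρ hρ).δ_comp]
  rfl

/-- Exactness at `Hᵏ(Π C)` (second copy): `ker δ = im (1 - shift)*`. [folklore] -/
theorem exists_of_milnorδ_eq_zero (k : ℕ) (Y : (piCx C).homology k) (hY : milnorδ C ρ hρ k Y = 0) :
    ∃ Y', HomologicalComplex.homologyMap (DMap C ρ) k Y' = Y :=
  (ShortComplex.moduleCat_exact_iff _).1 ((milnorSC_shortExact C ρ hρ).homology_exact₃ k (k + 1) (crel_up k)) Y hY

/-- Exactness at `Hᵏ⁺¹(lim C)`: `ker ι* = im δ`. [folklore] -/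
theorem exists_of_homologyMap_ιMap_eq_zero (k : ℕ) (x : (limCx C ρ).homology (k + 1))
    (hx : HomologicalComplex.homologyMap (ιMap C ρ) (k + 1) x = 0) : ∃ Y, milnorδ C ρ hρ k Y = x :=
  (ShortComplex.moduleCat_exact_iff _).1 ((milnorSC_shortExact C ρ hρ).homology_exact₁ k (k + 1) (crel_up k)) x hx

/-- **The Milnor injection `lim¹ Hᵏ(C(n)) → Hᵏ⁺¹(lim C(n))`**: the connecting map of the Milnor short
exact sequence, through `Hᵏ(Π C) = Π Hᵏ(C(n))`, descended to the cokernel of `1 - shift`.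
[cite: HatcherAT2002, §3.F Thm. 3F.8] -/
def milnorInj (k : ℕ) : towerLim1 (M := HTower C k) (ρH C ρ k) →ₗ[R] (limCx C ρ).homology (k + 1) :=
  (LinearMap.range (towerD (M := HTower C k) (ρH C ρ k))).liftQ
    ((milnorδ C ρ hρ k).hom.comp (piHomologyEquiv C k).symm.toLinearMap)
    (by
      rintro _ ⟨y, rfl⟩
      rw [LinearMap.mem_ker]
      obtain ⟨Y, hY⟩ := (piHomologyMap_bijective C k).2 y
      have h1 : (piHomologyEquiv C k).symm (towerD (M := HTower C k) (ρH C ρ k) y) =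
          HomologicalComplex.homologyMap (DMap C ρ) k Y := by
        apply (piHomologyEquiv C k).injective
        rw [LinearEquiv.apply_symm_apply, piHomologyEquiv_apply, piHomologyMap_homologyMap_DMap, hY]
      change milnorδ C ρ hρ k ((piHomologyEquiv C k).symm (towerD (M := HTower C k) (ρH C ρ k) y)) = 0
      rw [h1, milnorδ_homologyMap_DMap])

/-- The Milnor injection on the class of `(projₙ* Y)ₙ` is `δ Y`. [folklore] -/
theorem milnorInj_mk (k : ℕ) (Y : (piCx C).homology k) :
    milnorInj C ρ hρ k (Submodule.Quotient.mk (piHomologyMap C k Y)) = milnorδ C ρ hρ k Y := by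
  change milnorδ C ρ hρ k ((piHomologyEquiv C k).symm (piHomologyMap C k Y)) = _
  congr 1
  apply (piHomologyEquiv C k).injective
  rw [LinearEquiv.apply_symm_apply]
  rfl

/-- **The Milnor injection is injective.** [cite: HatcherAT2002, §3.F Thm. 3F.8] -/
theorem milnorInj_injective (k : ℕ) : Injective (milnorInj C ρ hρ k) := by
  rw [injective_iff_map_eq_zero]
  intro q hq
  induction q using Submodule.Quotient.induction_on with
  | H y =>
    obtain ⟨Y, rfl⟩ := (piHomologyMap_bijective C k).2 y
    rw [milnorInj_mk] at hq
    obtain ⟨Y', hY'⟩ := exists_of_milnorδ_eq_zero C ρ hρ k Y hq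
    rw [Submodule.Quotient.mk_eq_zero, LinearMap.mem_range]
    refine ⟨piHomologyMap C k Y', ?_⟩
    rw [← piHomologyMap_homologyMap_DMap]
    exact congrArg _ hY'

/-- **Exactness in the middle: `milnorSurj ∘ milnorInj = 0`.** [cite: HatcherAT2002, §3.F Thm. 3F.8] -/
theorem milnorSurj_milnorInj (k : ℕ) (q : towerLim1 (M := HTower C k) (ρH C ρ k)) :
    milnorSurj C ρ (k + 1) (milnorInj C ρ hρ k q) = 0 := by
  induction q using Submodule.Quotient.induction_on with
  | H y =>
    obtain ⟨Y, rfl⟩ := (piHomologyMap_bijective C k).2 y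
    apply Subtype.ext
    rw [milnorInj_mk, milnorSurj_apply_coe, homologyMap_ιMap_milnorδ, map_zero]
    rfl

/-- **Exactness in the middle: a class invisible on every `C(n)` comes from `lim¹`.** [cite: HatcherAT2002, §3.F Thm. 3F.8] -/
theorem exists_milnorInj_eq_of_milnorSurj_eq_zero (k : ℕ) (x : (limCx C ρ).homology (k + 1))
    (hx : milnorSurj C ρ (k + 1) x = 0) : ∃ q, milnorInj C ρ hρ k q = x := by
  have hι : HomologicalComplex.homologyMap (ιMap C ρ) (k + 1) x = 0 := by
    apply (piHomologyMap_bijective C (k + 1)).1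
    rw [map_zero]
    exact congrArg Subtype.val hx
  obtain ⟨Y, hY⟩ := exists_of_homologyMap_ιMap_eq_zero C ρ hρ k x hι
  exact ⟨Submodule.Quotient.mk (piHomologyMap C k Y), (milnorInj_mk C ρ hρ k Y).trans hY⟩

end Milnor

/-! ### `lim` and `lim¹` of levelwise isomorphisms -/

section Iso

variable {M : ℕ → Type w} [∀ n, AddCommGroup (M n)] [∀ n, Module R (M n)] (r : ∀ n, M (n + 1) →ₗ[R] M n)
  {N : ℕ → Type w} [∀ n, AddCommGroup (N n)] [∀ n, Module R (N n)] (s : ∀ n, N (n + 1) →ₗ[R] N n)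
  (f : ∀ n, M n →ₗ[R] N n) (hf : ∀ n (x : M (n + 1)), f n (r n x) = s n (f (n + 1) x))

/-- `lim` of a levelwise bijective morphism of towers is bijective. [folklore] -/
theorem towerLimMap_bijective (hb : ∀ n, Bijective (f n)) : Bijective (towerLimMap r s f hf) := by
  constructor
  · intro x y h
    apply Subtype.ext
    funext n
    exact (hb n).1 (congrFun (congrArg Subtype.val h) n)
  · intro y
    let e : ∀ n, M n ≃ₗ[R] N n := fun n ↦ LinearEquiv.ofBijective (f n) (hb n)
    refine ⟨⟨fun n ↦ (e n).symm (y.1 n), (mem_towerLim_iff r _).2 fun n ↦ ?_⟩, Subtype.ext (funext fun n ↦ ?_)⟩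
    · apply (hb n).1
      change f n (r n ((e (n + 1)).symm (y.1 (n + 1)))) = e n ((e n).symm (y.1 n))
      rw [hf, LinearEquiv.apply_symm_apply, show f (n + 1) ((e (n + 1)).symm (y.1 (n + 1))) = y.1 (n + 1) from
        (e (n + 1)).apply_symm_apply (y.1 (n + 1))]
      exact (mem_towerLim_iff s y.1).1 y.2 n
    · exact (e n).apply_symm_apply (y.1 n)

/-- `lim¹` of a levelwise bijective morphism of towers is bijective. [folklore] -/
theorem towerLim1Map_bijective (hb : ∀ n, Bijective (f n)) : Bijective (towerLim1Map r s f hf) := by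
  have hpi : Bijective (towerPiMap f) :=
    ⟨fun x y h ↦ funext fun n ↦ (hb n).1 (congrFun h n), fun y ↦ ⟨fun n ↦ surjInv (hb n).2 (y n),
      funext fun n ↦ surjInv_eq (hb n).2 (y n)⟩⟩
  constructor
  · rw [injective_iff_map_eq_zero]
    intro q hq
    induction q using Submodule.Quotient.induction_on with
    | H x =>
      rw [towerLim1Map_mk, Submodule.Quotient.mk_eq_zero, LinearMap.mem_range] at hq
      obtain ⟨y', hy'⟩ := hq
      obtain ⟨x', rfl⟩ := hpi.2 y'
      rw [towerD_towerPiMap r s f hf] at hy'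
      rw [Submodule.Quotient.mk_eq_zero, LinearMap.mem_range]
      exact ⟨x', hpi.1 hy'⟩
  · intro q
    induction q using Submodule.Quotient.induction_on with
    | H y =>
      obtain ⟨x, rfl⟩ := hpi.2 y
      exact ⟨Submodule.Quotient.mk x, rfl⟩

end Iso

/-! ### Naturality and the short five lemma -/

section Naturality

variable (C : ℕ → CochainComplex (ModuleCat.{w} R) ℕ) (ρ : ∀ n, C (n + 1) ⟶ C n)
  (C' : ℕ → CochainComplex (ModuleCat.{w} R) ℕ) (ρ' : ∀ n, C' (n + 1) ⟶ C' n)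
  (φ : ∀ n, C n ⟶ C' n) (hφ : ∀ n, ρ n ≫ φ n = φ (n + 1) ≫ ρ' n)

/-- The componentwise map `Π C(n) → Π C'(n)`. [folklore] -/
def piCxMap : piCx C ⟶ piCx C' where
  f k := ModuleCat.ofHom (towerPiMap (M := XTower C k) (N := XTower C' k) fun n ↦ ((φ n).f k).hom)
  comm' k l _ := by
    refine ModuleCat.hom_ext (LinearMap.ext fun x ↦ funext fun n ↦ ?_)
    change (C' n).d k l ((φ n).f k (x n)) = (φ n).f l ((C n).d k l (x n))
    rw [← ModuleCat.comp_apply, (φ n).comm k l, ModuleCat.comp_apply]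

/-- The componentwise map of complexes, applied. [folklore] -/
@[simp] theorem piCxMap_f_apply (k : ℕ) (x : ∀ n, (C n).X k) (n : ℕ) : (piCxMap C C' φ).f k x n = (φ n).f k (x n) := rfl

include hφ in
/-- The transition maps commute with a morphism of towers, applied. [folklore] -/
theorem φ_ρ_apply (k n : ℕ) (y : (C (n + 1)).X k) : (φ n).f k ((ρ n).f k y) = (ρ' n).f k ((φ (n + 1)).f k y) := by
  rw [← ModuleCat.comp_apply, ← HomologicalComplex.comp_f, hφ n, HomologicalComplex.comp_f, ModuleCat.comp_apply]

/-- The induced map of limit complexes. [folklore] -/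
def limCxMap : limCx C ρ ⟶ limCx C' ρ' where
  f k := ModuleCat.ofHom (towerLimMap (M := XTower C k) (N := XTower C' k) (ρLin C ρ k) (ρLin C' ρ' k)
    (fun n ↦ ((φ n).f k).hom) fun n y ↦ φ_ρ_apply C ρ C' ρ' φ hφ k n y)
  comm' k l _ := by
    refine ModuleCat.hom_ext (LinearMap.ext fun x ↦ Subtype.ext (funext fun n ↦ ?_))
    change (C' n).d k l ((φ n).f k (x.1 n)) = (φ n).f l ((C n).d k l (x.1 n))
    rw [← ModuleCat.comp_apply, (φ n).comm k l, ModuleCat.comp_apply]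

/-- The map of limit complexes, applied. [folklore] -/
@[simp] theorem limCxMap_f_apply_coe (k : ℕ) (x : limX C ρ k) (n : ℕ) :
    ((limCxMap C ρ C' ρ' φ hφ).f k x : limX C' ρ' k).1 n = (φ n).f k (x.1 n) := rfl

include hφ in
/-- `(1 - shift)` commutes with the componentwise map. [folklore] -/
theorem DMap_comp_piCxMap : DMap C ρ ≫ piCxMap C C' φ = piCxMap C C' φ ≫ DMap C' ρ' := by
  ext k x
  funext n
  change (φ n).f k (x n - (ρ n).f k (x (n + 1))) = (φ n).f k (x n) - (ρ' n).f k ((φ (n + 1)).f k (x (n + 1)))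
  rw [map_sub, φ_ρ_apply C ρ C' ρ' φ hφ]

/-- **The morphism of Milnor short exact sequences** induced by a morphism of towers. [folklore] -/
def milnorSCMap : milnorSC C ρ ⟶ milnorSC C' ρ' where
  τ₁ := limCxMap C ρ C' ρ' φ hφ
  τ₂ := piCxMap C C' φ
  τ₃ := piCxMap C C' φ
  comm₁₂ := by ext k x; rfl
  comm₂₃ := (DMap_comp_piCxMap C ρ C' ρ' φ hφ).symm

/-- The morphism of towers on cohomology. [folklore] -/
abbrev φH (k : ℕ) : ∀ n, HTower C k n →ₗ[R] HTower C' k n := fun n ↦ (HomologicalComplex.homologyMap (φ n) k).hom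

include hφ in
/-- It is a morphism of towers. [folklore] -/
theorem φH_ρH (k n : ℕ) (y : HTower C k (n + 1)) : φH C C' φ k n (ρH C ρ k n y) = ρH C' ρ' k n (φH C C' φ k (n + 1) y) := by
  change (HomologicalComplex.homologyMap (ρ n) k ≫ HomologicalComplex.homologyMap (φ n) k) y =
    (HomologicalComplex.homologyMap (φ (n + 1)) k ≫ HomologicalComplex.homologyMap (ρ' n) k) y
  rw [← HomologicalComplex.homologyMap_comp, ← HomologicalComplex.homologyMap_comp, hφ n]

/-- `Hᵏ(Π C) = Π Hᵏ(C(n))` is natural. [folklore] -/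
theorem piHomologyMap_homologyMap_piCxMap (k : ℕ) (Y : (piCx C).homology k) :
    piHomologyMap C' k (HomologicalComplex.homologyMap (piCxMap C C' φ) k Y) =
      towerPiMap (φH C C' φ k) (piHomologyMap C k Y) := by
  funext n
  rw [piHomologyMap_apply, towerPiMap_apply, piHomologyMap_apply, ← ModuleCat.comp_apply,
    ← HomologicalComplex.homologyMap_comp]
  change _ = (HomologicalComplex.homologyMap (piProj C n) k ≫ HomologicalComplex.homologyMap (φ n) k) Y
  rw [← HomologicalComplex.homologyMap_comp]
  rfl

/-- **The Milnor surjection is natural.** [folklore] -/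
theorem milnorSurj_natural (k : ℕ) (x : (limCx C ρ).homology k) :
    milnorSurj C' ρ' k (HomologicalComplex.homologyMap (limCxMap C ρ C' ρ' φ hφ) k x) =
      towerLimMap (ρH C ρ k) (ρH C' ρ' k) (φH C C' φ k) (fun n y ↦ φH_ρH C ρ C' ρ' φ hφ k n y) (milnorSurj C ρ k x) := by
  apply Subtype.ext
  rw [milnorSurj_apply_coe, ← ModuleCat.comp_apply, ← HomologicalComplex.homologyMap_comp]
  change piHomologyMap C' k (HomologicalComplex.homologyMap (ιMap C ρ ≫ piCxMap C C' φ) k x) = _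
  rw [HomologicalComplex.homologyMap_comp, ModuleCat.comp_apply, piHomologyMap_homologyMap_piCxMap]
  rfl

variable (hρ : ∀ n k, Surjective ((ρ n).f k)) (hρ' : ∀ n k, Surjective ((ρ' n).f k))

/-- **The connecting map is natural.** [folklore] -/
theorem milnorδ_natural (k : ℕ) (Y : (piCx C).homology k) :
    HomologicalComplex.homologyMap (limCxMap C ρ C' ρ' φ hφ) (k + 1) (milnorδ C ρ hρ k Y) =
      milnorδ C' ρ' hρ' k (HomologicalComplex.homologyMap (piCxMap C C' φ) k Y) := by
  change ((milnorSC_shortExact C ρ hρ).δ k (k + 1) (crel_up k) ≫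
    HomologicalComplex.homologyMap (milnorSCMap C ρ C' ρ' φ hφ).τ₁ (k + 1)) Y = _
  rw [HomologicalComplex.HomologySequence.δ_naturality (milnorSCMap C ρ C' ρ' φ hφ)
    (milnorSC_shortExact C ρ hρ) (milnorSC_shortExact C' ρ' hρ') k (k + 1) (crel_up k)]
  rfl

/-- **The Milnor injection is natural.** [folklore] -/
theorem milnorInj_natural (k : ℕ) (q : towerLim1 (M := HTower C k) (ρH C ρ k)) :
    HomologicalComplex.homologyMap (limCxMap C ρ C' ρ' φ hφ) (k + 1) (milnorInj C ρ hρ k q) =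
      milnorInj C' ρ' hρ' k (towerLim1Map (ρH C ρ k) (ρH C' ρ' k) (φH C C' φ k)
        (fun n y ↦ φH_ρH C ρ C' ρ' φ hφ k n y) q) := by
  induction q using Submodule.Quotient.induction_on with
  | H y =>
    obtain ⟨Y, rfl⟩ := (piHomologyMap_bijective C k).2 y
    rw [milnorInj_mk, towerLim1Map_mk, ← piHomologyMap_homologyMap_piCxMap, milnorInj_mk, milnorδ_natural]

include hρ hρ' in
/-- **Short five lemma for the Milnor sequences**: a morphism of epimorphic towers of complexes inducing
isomorphisms on `Hᵏ` and `Hᵏ⁺¹` of every stage induces an isomorphism on `Hᵏ⁺¹` of the limits.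
[cite: Weibel1994, §3.5 Thm. 3.5.8] -/
theorem homologyMap_limCxMap_bijective_succ (k : ℕ)
    (hk : ∀ n, Bijective (HomologicalComplex.homologyMap (φ n) k))
    (hk1 : ∀ n, Bijective (HomologicalComplex.homologyMap (φ n) (k + 1))) :
    Bijective (HomologicalComplex.homologyMap (limCxMap C ρ C' ρ' φ hφ) (k + 1)) := by
  set Φ := HomologicalComplex.homologyMap (limCxMap C ρ C' ρ' φ hφ) (k + 1) with hΦ
  have hlim := towerLimMap_bijective (ρH C ρ (k + 1)) (ρH C' ρ' (k + 1)) (φH C C' φ (k + 1))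
    (fun n y ↦ φH_ρH C ρ C' ρ' φ hφ (k + 1) n y) hk1
  have hlim1 := towerLim1Map_bijective (ρH C ρ k) (ρH C' ρ' k) (φH C C' φ k)
    (fun n y ↦ φH_ρH C ρ C' ρ' φ hφ k n y) hk
  constructor
  · rw [injective_iff_map_eq_zero]
    intro x hx
    have h1 : milnorSurj C ρ (k + 1) x = 0 := by
      apply hlim.1
      rw [map_zero, ← milnorSurj_natural C ρ C' ρ' φ hφ, ← hΦ, hx, map_zero]
    obtain ⟨q, rfl⟩ := exists_milnorInj_eq_of_milnorSurj_eq_zero C ρ hρ k x h1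
    have h2 : towerLim1Map (ρH C ρ k) (ρH C' ρ' k) (φH C C' φ k) (fun n y ↦ φH_ρH C ρ C' ρ' φ hφ k n y) q = 0 := by
      apply milnorInj_injective C' ρ' hρ' k
      rw [map_zero, ← milnorInj_natural C ρ C' ρ' φ hφ hρ hρ', ← hΦ, hx]
    rw [hlim1.1 (h2.trans (map_zero _).symm), map_zero]
  · intro x'
    obtain ⟨s, hs⟩ := hlim.2 (milnorSurj C' ρ' (k + 1) x')
    obtain ⟨x₀, rfl⟩ := milnorSurj_surjective C ρ hρ (k + 1) s
    have h1 : milnorSurj C' ρ' (k + 1) (x' - Φ x₀) = 0 := by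
      rw [map_sub, hΦ, milnorSurj_natural C ρ C' ρ' φ hφ, hs, sub_self]
    obtain ⟨q', hq'⟩ := exists_milnorInj_eq_of_milnorSurj_eq_zero C' ρ' hρ' k _ h1
    obtain ⟨q, rfl⟩ := hlim1.2 q'
    refine ⟨x₀ + milnorInj C ρ hρ k q, ?_⟩
    rw [map_add, hΦ, milnorInj_natural C ρ C' ρ' φ hφ hρ hρ', hq', ← hΦ, add_sub_cancel]

/-- In degree `0` the Milnor surjection is injective (no `lim¹` term). [folklore] -/
theorem milnorSurj_zero_injective : Injective (milnorSurj C ρ 0) := by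
  rw [injective_iff_map_eq_zero]
  intro x hx
  obtain ⟨z, hz, rfl⟩ := homologyCls_surjective (K := limCx C ρ) x
  have h0 : ∀ n, z.1 n = 0 := by
    intro n
    have h := congrFun (congrArg Subtype.val hx) n
    rw [milnorSurj_apply_coe, homologyMap_homologyCls, piHomologyMap_homologyCls] at h
    change homologyCls (K := C n) (z.1 n) _ = 0 at h
    rw [homologyCls_eq_zero_iff] at h
    obtain ⟨w, hw⟩ := h
    rw [← hw, (C n).shape _ _ (by simp)]
    rfl
  have hz0 : z = 0 := Subtype.ext (funext h0)
  subst hz0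
  exact homologyCls_zero (K := limCx C ρ) _

include hρ in
/-- **Short five lemma in degree `0`**: `H⁰(lim C) = lim H⁰(C(n))`, so levelwise isomorphisms on `H⁰`
give an isomorphism on `H⁰` of the limits. [cite: Weibel1994, §3.5 Thm. 3.5.8] -/
theorem homologyMap_limCxMap_bijective_zero (h0 : ∀ n, Bijective (HomologicalComplex.homologyMap (φ n) 0)) :
    Bijective (HomologicalComplex.homologyMap (limCxMap C ρ C' ρ' φ hφ) 0) := by
  set Φ := HomologicalComplex.homologyMap (limCxMap C ρ C' ρ' φ hφ) 0 with hΦ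
  have hlim := towerLimMap_bijective (ρH C ρ 0) (ρH C' ρ' 0) (φH C C' φ 0) (fun n y ↦ φH_ρH C ρ C' ρ' φ hφ 0 n y) h0
  constructor
  · intro x y h
    apply milnorSurj_zero_injective C ρ
    apply hlim.1
    rw [← milnorSurj_natural C ρ C' ρ' φ hφ, ← milnorSurj_natural C ρ C' ρ' φ hφ, ← hΦ, h]
  · intro x'
    obtain ⟨s, hs⟩ := hlim.2 (milnorSurj C' ρ' 0 x')
    obtain ⟨x₀, rfl⟩ := milnorSurj_surjective C ρ hρ 0 s
    refine ⟨x₀, milnorSurj_zero_injective C' ρ' ?_⟩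
    rw [hΦ, milnorSurj_natural C ρ C' ρ' φ hφ, hs]

end Naturality

end Literature.AlgebraicTopology.SingularHomology
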